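import Summits.KontsevichZagierPeriods.KontsevichZagierPeriods.Theses.WZCosetWall
import Summits.KontsevichZagierPeriods.KontsevichZagierPeriods.Theses.AyoubSpecialisation
import Summits.KontsevichZagierPeriods.KontsevichZagierPeriods.Theorems.VietaFibreKernelFormItemDictionary
import Literature.NumberTheory.Transcendental.KZKernelConjectureForms

/-!
# `SeriesKernel` (stmt-KontsevichZagierPeriods-6872) — the `[π]`-split glues (crux-strategist, route WZCosetWall)

Candidate proof of the GLUE of the strategist's decomposition of the crux `WZCosetWall.SeriesKernel`
(Conjecture 1 for the calculus KZ^Σ = four moves + dominated rational-geometric termwise summation,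
in `R`-form) along `[π]` (Kontsevich–Zagier 2001 §4.1, `P̂ = P[(2πi)⁻¹]`; Ayoub 2014 Def. 6 /
Conj. 7):

  `AyoubPiLocalKernel` (stmt-0541) → `AyoubPiCancellation` (stmt-0540) → `SeriesKernel`,

the children typed BY NAME as the two existing shared items of route AyoubSpecialisation (the
same cut and the same children as the landed glues `LiouvilleUnfoldingLogKernelConjectureSplitGlue`
(stmt-17107) and `MultivaluedCoVMultiCoVKernelSplitGlue`). Proof, unconditional and re-proving
nothing: the landed dictionary
`KernelForm.LocaliseAtValuePrime.kernelForm_iff_ayoubPiLocalKernel_and_ayoubPiCancellation`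
(`VietaFibre.KernelForm` is `KZKernelConjecture` on the nose) gives `ker eval ≤ relations`, and
`relations ≤ R` for every admissible `R` (the Σ-closure hypothesis of the crux is not needed in
this direction). The converse within the route — `SummationClosure → SeriesKernel → 0541 ∧ 0540` —
is recorded too (exactness of the cut modulo the route's engine), so neither child is the crux
weakened for free.

A prover lands this file verbatim as
`Summits/KontsevichZagierPeriods/KontsevichZagierPeriods/Theorems/WZCosetWallSeriesKernelSplit.lean`
(`ledger propose --kind proof --target … --supports stmt-KontsevichZagierPeriods-6872`; planners
cannot write under `Theorems/`, D-0016). Source: `Cruxes/SeriesKernel/Split.lean` (this file) and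
`Cruxes/SeriesKernel/StrategyCensus.lean` §3.

References: M. Kontsevich, D. Zagier, *Periods* (2001), §1.2 Conjecture 1, §4.1; J. Ayoub,
*Periods and the conjectures of Grothendieck and Kontsevich–Zagier*, EMS Newsl. 91 (2014), Def. 6 /
Conj. 7; A. Huber, G. Wüstholz, *Transcendence and linear relations of 1-periods* (2022), App. A.4.
-/

noncomputable section

namespace Summit.KontsevichZagierPeriods.WZCosetWall.SeriesKernelSplit

open Literature.NumberTheory.Transcendental
open Summit.KontsevichZagierPeriods.KontsevichZagierPeriods.Theses

/-- `KZKernelConjecture → SeriesKernel`: the crux is summit-implied (`relations ≤ R`; the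
Σ-closure hypothesis is unused). [Kontsevich–Zagier 2001, §1.2 Conjecture 1] [folklore] -/
theorem seriesKernel_of_kzKernelConjecture (h : KZKernelConjecture) : WZCosetWall.SeriesKernel :=
  fun _ hR _ c hc => hR (h c hc)

/-- `KontsevichZagierPeriods → SeriesKernel`. [Kontsevich–Zagier 2001, §1.2 Conjecture 1] [folklore] -/
theorem seriesKernel_of_summit (h : _root_.KontsevichZagierPeriods) : WZCosetWall.SeriesKernel :=
  seriesKernel_of_kzKernelConjecture (kzKernelConjecture_iff_isRational.mpr h)

/-- **THE GLUE `SeriesKernel_of_subs : AyoubPiLocalKernel → AyoubPiCancellation → SeriesKernel`**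
(stmt-0541 → stmt-0540 → stmt-6872), children by name. [Kontsevich–Zagier 2001, §4.1; Ayoub 2014,
Conj. 7] [folklore] -/
theorem SeriesKernel_of_subs :
    AyoubSpecialisation.AyoubPiLocalKernel → AyoubSpecialisation.AyoubPiCancellation →
      WZCosetWall.SeriesKernel := fun h₁ h₂ =>
  seriesKernel_of_kzKernelConjecture
    (show KZKernelConjecture from
      Summit.KontsevichZagierPeriods.KernelForm.LocaliseAtValuePrime.kernelForm_iff_ayoubPiLocalKernel_and_ayoubPiCancellation.mpr
        ⟨h₁, h₂⟩)

/-- The same glue with the children's bodies written out — the literal statements of items 0541 and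
0540, i.e. the type of the glue item `Sub₁ → Sub₂ → SeriesKernel` that `route edit --split … --into
children.json` generates. [folklore] -/
theorem SeriesKernel_of_subs' :
    (∀ (P : ∀ n : ℕ, Literature.NumberTheory.Transcendental.KZ.IntegralRep n → Literature.NumberTheory.Transcendental.KZ.IntegralRep (n + 2)), (∀ (n : ℕ) (r : Literature.NumberTheory.Transcendental.KZ.IntegralRep n), (P n r).domain = {z : Fin (n + 2) → ℝ | z 0 ^ 2 + z 1 ^ 2 ≤ 1 ∧ (fun i : Fin n => z i.succ.succ) ∈ r.domain} ∧ (P n r).integrand = fun z => r.integrand (fun i : Fin n => z i.succ.succ)) → ∀ c : Literature.NumberTheory.Transcendental.KZ.FormalRep, Literature.NumberTheory.Transcendental.KZ.eval c = 0 → ∃ N : ℕ, (⇑(FreeAbelianGroup.lift (fun s : (Σ n, Literature.NumberTheory.Transcendental.KZ.IntegralRep n) => Literature.NumberTheory.Transcendental.KZ.of (P s.1 s.2))))^[N] c ∈ Literature.NumberTheory.Transcendental.KZ.relations) →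
    (∀ (P : ∀ n : ℕ, Literature.NumberTheory.Transcendental.KZ.IntegralRep n → Literature.NumberTheory.Transcendental.KZ.IntegralRep (n + 2)), (∀ (n : ℕ) (r : Literature.NumberTheory.Transcendental.KZ.IntegralRep n), (P n r).domain = {z : Fin (n + 2) → ℝ | z 0 ^ 2 + z 1 ^ 2 ≤ 1 ∧ (fun i : Fin n => z i.succ.succ) ∈ r.domain} ∧ (P n r).integrand = fun z => r.integrand (fun i : Fin n => z i.succ.succ)) → ∀ c : Literature.NumberTheory.Transcendental.KZ.FormalRep, FreeAbelianGroup.lift (fun s : (Σ n, Literature.NumberTheory.Transcendental.KZ.IntegralRep n) => Literature.NumberTheory.Transcendental.KZ.of (P s.1 s.2)) c ∈ Literature.NumberTheory.Transcendental.KZ.relations → c ∈ Literature.NumberTheory.Transcendental.KZ.relations) →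
    WZCosetWall.SeriesKernel :=
  SeriesKernel_of_subs

/-- **Exactness of the cut modulo the route's engine.** Under `SummationClosure` (the other binder
of the route's `closes`), `SeriesKernel ↔ AyoubPiLocalKernel ∧ AyoubPiCancellation`.
[Kontsevich–Zagier 2001, §1.2, §4.1] [folklore] -/
theorem seriesKernel_iff_subs_of_summationClosure (hS : WZCosetWall.SummationClosure) :
    WZCosetWall.SeriesKernel ↔
      AyoubSpecialisation.AyoubPiLocalKernel ∧ AyoubSpecialisation.AyoubPiCancellation := by
  constructor
  · intro hK
    exact Summit.KontsevichZagierPeriods.KernelForm.LocaliseAtValuePrime.kernelForm_iff_ayoubPiLocalKernel_and_ayoubPiCancellation.mp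
      (fun c hc => hK KZ.relations le_rfl hS c hc)
  · rintro ⟨h₁, h₂⟩
    exact SeriesKernel_of_subs h₁ h₂

end Summit.KontsevichZagierPeriods.WZCosetWall.SeriesKernelSplit

end
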